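import Mathlib
import HarnessLib

/-!
# Expected exponential moments do not force a fixed level with probability `→ 1` (abstract witness)

Supporting file of the line `Sketch` for the crux `AprioriBounds` (stmt-AtomisticToContinuum-14827;
`StiffCollisionalRelaxation.AprioriBounds` = `CollisionIsometryCLT.AprioriBoundsPreShock`), lead prover
`prover-line-stmt-AtomisticToContinuum-14827-c4-0`, reshape r7 of component (i).

Component (i) of the crux asks `P_N{C < ∫₀ᵗ (N+1)⁻¹∑ᵢ e^{λ|vᵢ(s)|²} ds} → 0` with a level `C` FIXED in `N`.  Reshape r7
derives it from an EXPECTED Gaussian moment along the flow (Nachtergaele–Yau II.1, the body of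
`SpeedCapSurgery.GaussianVelocityTails`) plus a fixed-time concentration statement.  This file is the kernel-checked
reason why the second input cannot be dropped: `expMoment_bounds_not_sufficient` exhibits, on ONE probability space of
"scenarios" `j ∈ ℕ` (so the randomness is `N`-independent, as for a macroscopic mixture), nonnegative "speeds²"
`s N j i` (`i < N + 1`) with energy per particle `≤ 2`, ALL of whose expected empirical exponential moments
`E (N+1)⁻¹∑ᵢ e^{c sᵢ}` (`c ∈ ℝ`) are bounded uniformly in `N`, and yet for every rate `λ > 0` and every level `K`
the probability of `{K < (N+1)⁻¹∑ᵢ e^{λ sᵢ}}` does NOT tend to `0`.  (Symmetrising the labels changes none of the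
three displayed quantities, so exchangeability does not help either.)

The witness: weights `w_j = 2^{-(j+1)} e^{-(j+2)²}` (normalised), level `K_j = j + 2`, and in scenario `j` the first
`m = ⌊2(N+1)/(j+2)⌋` particles at speed² `K_j`, the others at rest: energy `≤ 2`; every term `e^{c s} ≤ e^{|c|(j+2)}` and
`w_j e^{|c|(j+2)} ≤ 2^{-(j+1)} e^{c²/4}`; while for `N + 1 ≥ j + 2` the empirical `λ`-moment in scenario `j` is
`≥ e^{λ(j+2)}/(j+2) ≥ λ²(j+2)/2`, unbounded in `j`, so each level `K` is exceeded on a FIXED scenario of positive weight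
for all large `N`.

No definitions, no named facts; axioms `propext`, `Classical.choice`, `Quot.sound`.
-/

noncomputable section

open MeasureTheory Filter Set Topology
open scoped ENNReal

namespace Summit.AtomisticToContinuum.HydrodynamicLimit.Theorems.AprioriBoundsNegative

/-- The counting identity behind the witness: `∑_{i < n} 𝟙(i < m) = min m n`. -/
theorem sum_range_ite_lt (n m : ℕ) (a : ℝ) :
    ∑ i ∈ Finset.range n, (if i < m then a else 0) = (min m n : ℕ) * a := by
  rw [Finset.sum_ite, Finset.sum_const_zero, add_zero, Finset.sum_const, nsmul_eq_mul]
  congr 2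
  have : (Finset.range n).filter (fun i => i < m) = Finset.range (min m n) := by
    ext i
    simp only [Finset.mem_filter, Finset.mem_range, lt_min_iff]
    tauto
  rw [this, Finset.card_range]

/-- **Expected exponential moments of every rate plus bounded energy do not put the empirical exponential moment
below any fixed level with probability `→ 1`.**  See the module docstring for the witness. -/
theorem expMoment_bounds_not_sufficient :
    ∃ P : Measure ℕ, IsProbabilityMeasure P ∧ ∃ s : ℕ → ℕ → ℕ → ℝ,
      (∀ N j i, 0 ≤ s N j i) ∧
      (∀ N j, ((N + 1 : ℕ) : ℝ)⁻¹ * ∑ i ∈ Finset.range (N + 1), s N j i ≤ 2) ∧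
      (∀ c : ℝ, ∃ C : ℝ≥0∞, C < ⊤ ∧ ∀ N : ℕ,
        ∫⁻ j, ENNReal.ofReal (((N + 1 : ℕ) : ℝ)⁻¹ * ∑ i ∈ Finset.range (N + 1), Real.exp (c * s N j i)) ∂P
          ≤ C) ∧
      (∀ lam : ℝ, 0 < lam → ∀ K : ℝ, ¬ Tendsto (fun N : ℕ => P {j | K < ((N + 1 : ℕ) : ℝ)⁻¹ *
        ∑ i ∈ Finset.range (N + 1), Real.exp (lam * s N j i)}) atTop (𝓝 0)) := by
  classical
  -- the weights and the probability law on scenarios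
  set w : ℕ → ℝ≥0∞ := fun j => (2⁻¹ : ℝ≥0∞) ^ (j + 1) * ENNReal.ofReal (Real.exp (-((j : ℝ) + 2) ^ 2)) with hw
  have hw_le : ∀ j, w j ≤ (2⁻¹ : ℝ≥0∞) ^ j := by
    intro j
    calc w j ≤ (2⁻¹ : ℝ≥0∞) ^ (j + 1) * 1 := by
          simp only [hw]
          gcongr
          rw [← ENNReal.ofReal_one]
          exact ENNReal.ofReal_le_ofReal (Real.exp_le_one_iff.2 (by nlinarith [sq_nonneg ((j : ℝ) + 2)]))
      _ ≤ (2⁻¹ : ℝ≥0∞) ^ j := by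
          rw [mul_one, pow_succ]
          exact mul_le_of_le_one_right' (by norm_num)
  have hgeom : ∑' j : ℕ, (2⁻¹ : ℝ≥0∞) ^ j = 2 := by
    rw [ENNReal.tsum_geometric, ENNReal.one_sub_inv_two, inv_inv]
  have hZtop : ∑' j, w j ≠ ⊤ := by
    refine ne_top_of_le_ne_top (by simp [hgeom] : (∑' j : ℕ, (2⁻¹ : ℝ≥0∞) ^ j) ≠ ⊤) ?_
    exact ENNReal.tsum_le_tsum hw_le
  have hw0pos : 0 < w 0 := by
    simp only [hw]
    exact ENNReal.mul_pos (by simp) (ENNReal.ofReal_pos.2 (Real.exp_pos _)).ne'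
  have hZ0 : ∑' j, w j ≠ 0 := fun h => (ENNReal.tsum_eq_zero.1 h 0 ▸ hw0pos).false
  set p : PMF ℕ := PMF.normalize w hZ0 hZtop with hp
  have hp_apply : ∀ j, p j = w j * (∑' k, w k)⁻¹ := fun j => PMF.normalize_apply hZ0 hZtop j
  set P : Measure ℕ := p.toMeasure with hP
  -- the speeds
  set m : ℕ → ℕ → ℕ := fun N j => (2 * (N + 1)) / (j + 2) with hm
  set s : ℕ → ℕ → ℕ → ℝ := fun N j i => if i < m N j then ((j : ℝ) + 2) else 0 with hs
  have hs0 : ∀ N j i, 0 ≤ s N j i := fun N j i => by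
    simp only [hs]
    split_ifs <;> positivity
  have hsle : ∀ N j i, s N j i ≤ (j : ℝ) + 2 := fun N j i => by
    simp only [hs]
    split_ifs
    · exact le_rfl
    · positivity
  have hNpos : ∀ N : ℕ, (0 : ℝ) < ((N + 1 : ℕ) : ℝ) := fun N => by positivity
  refine ⟨P, PMF.toMeasure.isProbabilityMeasure p, s, hs0, ?_, ?_, ?_⟩
  · -- energy per particle ≤ 2
    intro N j
    have hsum : ∑ i ∈ Finset.range (N + 1), s N j i = (min (m N j) (N + 1) : ℕ) * ((j : ℝ) + 2) := by
      simp only [hs]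
      exact sum_range_ite_lt (N + 1) (m N j) _
    rw [hsum, inv_mul_le_iff₀ (hNpos N)]
    have h1 : ((min (m N j) (N + 1) : ℕ) : ℝ) ≤ (m N j : ℝ) := by exact_mod_cast min_le_left _ _
    have h2 : (m N j : ℝ) * ((j : ℝ) + 2) ≤ 2 * ((N + 1 : ℕ) : ℝ) := by
      have h := Nat.div_mul_le_self (2 * (N + 1)) (j + 2)
      have h' : ((2 * (N + 1) / (j + 2) * (j + 2) : ℕ) : ℝ) ≤ ((2 * (N + 1) : ℕ) : ℝ) := by exact_mod_cast h
      simp only [hm]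
      push_cast at h' ⊢
      linarith
    calc ((min (m N j) (N + 1) : ℕ) : ℝ) * ((j : ℝ) + 2) ≤ (m N j : ℝ) * ((j : ℝ) + 2) :=
          mul_le_mul_of_nonneg_right h1 (by positivity)
      _ ≤ 2 * ((N + 1 : ℕ) : ℝ) := h2
      _ = ((N + 1 : ℕ) : ℝ) * 2 := mul_comm _ _
  · -- every expected exponential moment is bounded, uniformly in `N`
    intro c
    refine ⟨(∑' k, w k)⁻¹ * (ENNReal.ofReal (Real.exp (|c| ^ 2 / 4)) * 2), ?_, fun N => ?_⟩
    · exact ENNReal.mul_lt_top (ENNReal.inv_lt_top.2 (pos_iff_ne_zero.2 hZ0))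
        (ENNReal.mul_lt_top ENNReal.ofReal_lt_top ENNReal.ofNat_lt_top)
    -- pointwise: the empirical moment in scenario `j` is ≤ e^{|c|(j+2)}
    have havg : ∀ j, ENNReal.ofReal (((N + 1 : ℕ) : ℝ)⁻¹ * ∑ i ∈ Finset.range (N + 1), Real.exp (c * s N j i))
        ≤ ENNReal.ofReal (Real.exp (|c| * ((j : ℝ) + 2))) := by
      intro j
      refine ENNReal.ofReal_le_ofReal ?_
      have hterm : ∀ i ∈ Finset.range (N + 1), Real.exp (c * s N j i) ≤ Real.exp (|c| * ((j : ℝ) + 2)) := by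
        intro i _
        refine Real.exp_le_exp.2 ?_
        calc c * s N j i ≤ |c| * s N j i := mul_le_mul_of_nonneg_right (le_abs_self c) (hs0 N j i)
          _ ≤ |c| * ((j : ℝ) + 2) := mul_le_mul_of_nonneg_left (hsle N j i) (abs_nonneg c)
      calc ((N + 1 : ℕ) : ℝ)⁻¹ * ∑ i ∈ Finset.range (N + 1), Real.exp (c * s N j i)
          ≤ ((N + 1 : ℕ) : ℝ)⁻¹ * ∑ _i ∈ Finset.range (N + 1), Real.exp (|c| * ((j : ℝ) + 2)) :=
            mul_le_mul_of_nonneg_left (Finset.sum_le_sum hterm) (by positivity)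
        _ = Real.exp (|c| * ((j : ℝ) + 2)) := by
            rw [Finset.sum_const, Finset.card_range, nsmul_eq_mul, ← mul_assoc,
              inv_mul_cancel₀ (hNpos N).ne', one_mul]
    -- termwise: e^{|c|(j+2)} w_j ≤ 2^{-j} e^{c²/4}
    have hterm : ∀ j : ℕ, ENNReal.ofReal (Real.exp (|c| * ((j : ℝ) + 2))) * w j ≤
        ENNReal.ofReal (Real.exp (|c| ^ 2 / 4)) * (2⁻¹ : ℝ≥0∞) ^ j := by
      intro j
      have hexp : Real.exp (|c| * ((j : ℝ) + 2)) * Real.exp (-((j : ℝ) + 2) ^ 2) ≤ Real.exp (|c| ^ 2 / 4) := by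
        rw [← Real.exp_add]
        exact Real.exp_le_exp.2 (by nlinarith [sq_nonneg (((j : ℝ) + 2) - |c| / 2)])
      calc ENNReal.ofReal (Real.exp (|c| * ((j : ℝ) + 2))) * w j
          = (2⁻¹ : ℝ≥0∞) ^ (j + 1) * (ENNReal.ofReal (Real.exp (|c| * ((j : ℝ) + 2))) *
              ENNReal.ofReal (Real.exp (-((j : ℝ) + 2) ^ 2))) := by
            simp only [hw]; ring
        _ ≤ (2⁻¹ : ℝ≥0∞) ^ j * ENNReal.ofReal (Real.exp (|c| ^ 2 / 4)) := by
            refine mul_le_mul' ?_ ?_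
            · rw [pow_succ]; exact mul_le_of_le_one_right' (by norm_num)
            · rw [← ENNReal.ofReal_mul (Real.exp_pos _).le]
              exact ENNReal.ofReal_le_ofReal hexp
        _ = ENNReal.ofReal (Real.exp (|c| ^ 2 / 4)) * (2⁻¹ : ℝ≥0∞) ^ j := mul_comm _ _
    calc ∫⁻ j, ENNReal.ofReal (((N + 1 : ℕ) : ℝ)⁻¹ * ∑ i ∈ Finset.range (N + 1), Real.exp (c * s N j i)) ∂P
        = ∑' j, ENNReal.ofReal (((N + 1 : ℕ) : ℝ)⁻¹ * ∑ i ∈ Finset.range (N + 1), Real.exp (c * s N j i)) *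
            P {j} := lintegral_countable' _
      _ ≤ ∑' j : ℕ, ENNReal.ofReal (Real.exp (|c| * ((j : ℝ) + 2))) * (w j * (∑' k, w k)⁻¹) := by
          refine ENNReal.tsum_le_tsum fun j => ?_
          rw [hP, PMF.toMeasure_apply_singleton p j (measurableSet_singleton j), hp_apply]
          exact mul_le_mul' (havg j) le_rfl
      _ = (∑' k, w k)⁻¹ * ∑' j : ℕ, ENNReal.ofReal (Real.exp (|c| * ((j : ℝ) + 2))) * w j := by
          rw [← ENNReal.tsum_mul_left]
          congr 1; funext j; ring
      _ ≤ (∑' k, w k)⁻¹ * ∑' j : ℕ, ENNReal.ofReal (Real.exp (|c| ^ 2 / 4)) * (2⁻¹ : ℝ≥0∞) ^ j := by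
          exact mul_le_mul' le_rfl (ENNReal.tsum_le_tsum hterm)
      _ = (∑' k, w k)⁻¹ * (ENNReal.ofReal (Real.exp (|c| ^ 2 / 4)) * 2) := by
          rw [ENNReal.tsum_mul_left, hgeom]
  · -- no level is exceeded with vanishing probability
    intro lam hlam K hT
    -- the scenario `j⋆` on which the `λ`-moment exceeds `K` for all large `N`
    obtain ⟨j, hj⟩ : ∃ j : ℕ, 2 * (|K| + 1) / lam ^ 2 ≤ (j : ℝ) + 2 := by
      obtain ⟨j, hj⟩ := exists_nat_ge (2 * (|K| + 1) / lam ^ 2)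
      exact ⟨j, hj.trans (by linarith)⟩
    have hlam2 : 0 < lam ^ 2 := by positivity
    have hKj : K < Real.exp (lam * ((j : ℝ) + 2)) / ((j : ℝ) + 2) := by
      have hx : 0 < (j : ℝ) + 2 := by positivity
      have hquad : (lam * ((j : ℝ) + 2)) ^ 2 / 2 ≤ Real.exp (lam * ((j : ℝ) + 2)) := by
        have h := Real.quadratic_le_exp_of_nonneg (by positivity : 0 ≤ lam * ((j : ℝ) + 2))
        nlinarith [h, sq_nonneg (lam * ((j : ℝ) + 2))]
      rw [lt_div_iff₀ hx]
      have h1 : 2 * (|K| + 1) ≤ lam ^ 2 * ((j : ℝ) + 2) := by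
        rw [div_le_iff₀ hlam2] at hj
        linarith
      have h2 : K * ((j : ℝ) + 2) < (lam * ((j : ℝ) + 2)) ^ 2 / 2 := by
        nlinarith [le_abs_self K, hx]
      linarith
    have hpj : 0 < P {j} := by
      rw [hP, PMF.toMeasure_apply_singleton p j (measurableSet_singleton j), hp_apply]
      refine ENNReal.mul_pos ?_ (ENNReal.inv_ne_zero.2 hZtop)
      simp only [hw]
      exact (ENNReal.mul_pos (by simp) (ENNReal.ofReal_pos.2 (Real.exp_pos _)).ne').ne'
    -- for `N + 1 ≥ j + 2` the scenario `j` lies in the bad event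
    have hmem : ∀ N : ℕ, j + 2 ≤ N + 1 → j ∈ {j | K < ((N + 1 : ℕ) : ℝ)⁻¹ *
        ∑ i ∈ Finset.range (N + 1), Real.exp (lam * s N j i)} := by
      intro N hN
      simp only [mem_setOf_eq]
      -- the hot count `m` satisfies `m ≤ N + 1` and `m (j+2) ≥ N + 1`
      have hm_le : m N j ≤ N + 1 := by
        simp only [hm]
        calc 2 * (N + 1) / (j + 2) ≤ 2 * (N + 1) / 2 := Nat.div_le_div_left (by omega) two_pos
          _ = N + 1 := by omega
      have hm_ge : N + 1 ≤ m N j * (j + 2) := by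
        simp only [hm]
        have h := Nat.lt_div_mul_add (a := 2 * (N + 1)) (b := j + 2) (by omega)
        -- `2(N+1) < m (j+2) + (j+2)` and `j + 2 ≤ N + 1`
        omega
      have hsum : ∑ i ∈ Finset.range (N + 1), Real.exp (lam * s N j i) ≥
          (m N j : ℝ) * Real.exp (lam * ((j : ℝ) + 2)) := by
        have heq : ∀ i ∈ Finset.range (N + 1), Real.exp (lam * s N j i) =
            (if i < m N j then Real.exp (lam * ((j : ℝ) + 2)) else 1) := by
          intro i _
          simp only [hs]
          split_ifs <;> simp
        rw [Finset.sum_congr rfl heq, Finset.sum_ite, Finset.sum_const, Finset.sum_const, nsmul_eq_mul,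
          nsmul_eq_mul, mul_one]
        have hcard : ((Finset.range (N + 1)).filter (fun i => i < m N j)).card = m N j := by
          have : (Finset.range (N + 1)).filter (fun i => i < m N j) = Finset.range (m N j) := by
            ext i
            simp only [Finset.mem_filter, Finset.mem_range]
            constructor
            · exact fun h => h.2
            · exact fun h => ⟨lt_of_lt_of_le h hm_le, h⟩
          rw [this, Finset.card_range]
        rw [hcard]
        have hnn : (0 : ℝ) ≤ (((Finset.range (N + 1)).filter (fun i => ¬ i < m N j)).card : ℝ) := by positivity
        linarith
      have hfrac : Real.exp (lam * ((j : ℝ) + 2)) / ((j : ℝ) + 2) ≤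
          ((N + 1 : ℕ) : ℝ)⁻¹ * ((m N j : ℝ) * Real.exp (lam * ((j : ℝ) + 2))) := by
        have hx : 0 < (j : ℝ) + 2 := by positivity
        have h : ((N + 1 : ℕ) : ℝ) ≤ (m N j : ℝ) * ((j : ℝ) + 2) := by
          have h' : ((N + 1 : ℕ) : ℝ) ≤ ((m N j * (j + 2) : ℕ) : ℝ) := by exact_mod_cast hm_ge
          push_cast at h' ⊢
          exact h'
        have h1 : 1 / ((j : ℝ) + 2) ≤ (m N j : ℝ) / ((N + 1 : ℕ) : ℝ) := by
          rw [div_le_div_iff₀ hx (hNpos N)]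
          linarith
        calc Real.exp (lam * ((j : ℝ) + 2)) / ((j : ℝ) + 2)
            = Real.exp (lam * ((j : ℝ) + 2)) * (1 / ((j : ℝ) + 2)) := by rw [mul_one_div]
          _ ≤ Real.exp (lam * ((j : ℝ) + 2)) * ((m N j : ℝ) / ((N + 1 : ℕ) : ℝ)) :=
              mul_le_mul_of_nonneg_left h1 (Real.exp_pos _).le
          _ = ((N + 1 : ℕ) : ℝ)⁻¹ * ((m N j : ℝ) * Real.exp (lam * ((j : ℝ) + 2))) := by
              rw [div_eq_mul_inv]
              ring
      calc K < Real.exp (lam * ((j : ℝ) + 2)) / ((j : ℝ) + 2) := hKj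
        _ ≤ ((N + 1 : ℕ) : ℝ)⁻¹ * ((m N j : ℝ) * Real.exp (lam * ((j : ℝ) + 2))) := hfrac
        _ ≤ ((N + 1 : ℕ) : ℝ)⁻¹ * ∑ i ∈ Finset.range (N + 1), Real.exp (lam * s N j i) :=
            mul_le_mul_of_nonneg_left hsum (by positivity)
    -- hence the bad probability is eventually ≥ `P {j⋆} > 0`, contradicting `→ 0`
    have hev := (ENNReal.tendsto_nhds_zero.1 hT (P {j} / 2) (ENNReal.half_pos hpj.ne')).and
      (eventually_ge_atTop (j + 1))
    obtain ⟨N, hN1, hN2⟩ := hev.exists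
    have hle : P {j} ≤ P {j' | K < ((N + 1 : ℕ) : ℝ)⁻¹ * ∑ i ∈ Finset.range (N + 1), Real.exp (lam * s N j' i)} :=
      measure_mono (singleton_subset_iff.2 (hmem N (by omega)))
    have hlt : P {j} / 2 < P {j} := ENNReal.half_lt_self hpj.ne' (measure_ne_top P _)
    exact absurd (hle.trans hN1) (not_le.2 hlt)

end Summit.AtomisticToContinuum.HydrodynamicLimit.Theorems.AprioriBoundsNegative
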